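import Mathlib

/-!
# SoloBlind — the telescoping slaving identity (PLATEAU, LEMMA S; paper §24.97 (H))

In the renewal form of the leaf chain, `u = (r₁, w)` with `w′ = D(t) w + f(t) r₁`, the complement
`w` is expanded in derivatives of the slow amplitude: with the FORCED RESPONSES
`W₁′ = D W₁ + f`, `W_{k+1}′ = D W_{k+1} + W_k`, the partial sums
`w_K := Σ_{k<K} (-1)^k W_{k+1} r₁^{(k)}` satisfy EXACTLY
`w_K′ = D w_K + f r₁ + (-1)^{K+1} W_K r₁^{(K)}`,
so `w - w_K` solves the complement equation forced by `(-1)^K W_K r₁^{(K)}` only — the remainder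
that LEMMA C (contraction of the complement propagator) controls. This file proves the identity as
pure algebra: `A` is any ring, `d : A →+ A` any additive map with the Leibniz rule (time derivative
on a ring of operator-valued functions), `W 0` plays the role of `f` so that the recursion is
uniform, and `r^{(k)} = d^[k] r`. No analysis is involved; the application instantiates `A` with
matrices of smooth functions (scalars and columns embedded as matrices).
-/

namespace Summit.AnomalousDissipation.AnomalousDissipation.Theorems

open Finset

variable {A : Type*} [Ring A]

/-- A Leibniz additive map kills `1`. -/
theorem telescopeLeibniz_map_one (d : A →+ A) (leib : ∀ x y : A, d (x * y) = d x * y + x * d y) :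
    d 1 = 0 := by
  have h := leib 1 1
  simp at h
  exact h

/-- A Leibniz additive map kills the signs `(-1)^k`. -/
theorem telescopeLeibniz_map_neg_one_pow (d : A →+ A) (leib : ∀ x y : A, d (x * y) = d x * y + x * d y)
    (k : ℕ) : d ((-1 : A) ^ k) = 0 := by
  induction k with
  | zero => simpa using telescopeLeibniz_map_one d leib
  | succ k ih =>
      rw [pow_succ, leib, ih, map_neg, telescopeLeibniz_map_one d leib]
      simp

/-- Signs pass through a Leibniz map. -/
theorem telescopeLeibniz_map_sign_mul (d : A →+ A) (leib : ∀ x y : A, d (x * y) = d x * y + x * d y)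
    (k : ℕ) (x : A) : d ((-1 : A) ^ k * x) = (-1 : A) ^ k * d x := by
  rw [leib, telescopeLeibniz_map_neg_one_pow d leib k, zero_mul, zero_add]

/-- Signs are central. -/
theorem telescopeSign_mul_comm (k : ℕ) (D x : A) : D * ((-1 : A) ^ k * x) = (-1 : A) ^ k * (D * x) := by
  have hc : (-1 : A) ^ k * D = D * (-1 : A) ^ k := ((Commute.neg_one_left D).pow_left k).eq
  rw [← mul_assoc, ← hc, mul_assoc]

/-- THE TELESCOPING SLAVING IDENTITY. Let `d` be additive with the Leibniz rule, `D r : A`, and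
`W : ℕ → A` the forced responses `d (W (k+1)) = D * W (k+1) + W k` (so `W 0` is the forcing `f`).
Then for every order `K`,
`d (Σ_{k<K} (-1)^k W_{k+1} d^[k] r) = D (Σ_{k<K} (-1)^k W_{k+1} d^[k] r) + W 0 * r + (-1)^(K+1) W_K d^[K] r`. -/
theorem slaving_telescope (d : A →+ A) (leib : ∀ x y : A, d (x * y) = d x * y + x * d y)
    (D r : A) (W : ℕ → A) (hW : ∀ k, d (W (k + 1)) = D * W (k + 1) + W k) (K : ℕ) :
    d (∑ k ∈ range K, (-1 : A) ^ k * (W (k + 1) * d^[k] r))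
      = D * (∑ k ∈ range K, (-1 : A) ^ k * (W (k + 1) * d^[k] r))
        + W 0 * r + (-1 : A) ^ (K + 1) * (W K * d^[K] r) := by
  induction K with
  | zero => simp
  | succ K ih =>
      rw [sum_range_succ, map_add, ih, telescopeLeibniz_map_sign_mul d leib, leib, hW K]
      simp only [mul_add, add_mul]
      rw [telescopeSign_mul_comm K D]
      have e1 : d^[K + 1] r = d (d^[K] r) := Function.iterate_succ_apply' d K r
      have s1 : (-1 : A) ^ (K + 1) = -((-1 : A) ^ K) := by rw [pow_succ]; simp
      have s2 : (-1 : A) ^ (K + 1 + 1) = (-1 : A) ^ K := by rw [pow_succ, pow_succ]; simp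
      rw [e1, s1, s2]
      noncomm_ring

/-- Order one (the Markovian slaving `w ≈ W₁ r`): `d (W₁ r) = D (W₁ r) + f r + W₁ r′`. -/
theorem slaving_telescope_one (d : A →+ A) (leib : ∀ x y : A, d (x * y) = d x * y + x * d y)
    (D r : A) (W : ℕ → A) (hW : ∀ k, d (W (k + 1)) = D * W (k + 1) + W k) :
    d (W 1 * r) = D * (W 1 * r) + W 0 * r + W 1 * d r := by
  have h1 : d (W 1) = D * W 1 + W 0 := by simpa using hW 0
  rw [leib, h1]
  noncomm_ring

/-- Order two (`w ≈ W₁ r - W₂ r′`, the order at which the first memory correction enters):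
`d (W₁ r - W₂ r′) = D (W₁ r - W₂ r′) + f r - W₂ r″`. -/
theorem slaving_telescope_two (d : A →+ A) (leib : ∀ x y : A, d (x * y) = d x * y + x * d y)
    (D r : A) (W : ℕ → A) (hW : ∀ k, d (W (k + 1)) = D * W (k + 1) + W k) :
    d (W 1 * r - W 2 * d r) = D * (W 1 * r - W 2 * d r) + W 0 * r - W 2 * d (d r) := by
  have h1 : d (W 1) = D * W 1 + W 0 := by simpa using hW 0
  have h2 : d (W 2) = D * W 2 + W 1 := by simpa using hW 1
  rw [map_sub, leib, leib, h1, h2]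
  noncomm_ring

end Summit.AnomalousDissipation.AnomalousDissipation.Theorems
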